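import Literature.Analysis.FluidPDE.FluidComputer.ThresholdLevelTableX
import HarnessLib

/-!
# Kernel run of the level-table checker over the WIDER gate-data box (all seven data within 1/300), chunks 12 … 15 (bp3 gen 13, layer 4: robustness variant X)

HONEST FRAMING: low prior, high value-of-information experiment on Tao's machine paradigm; NOT a
claim that NS blows up.

Four kernel evaluations (`decide +kernel`; no `native_decide`, no extra axioms) of `runSteps`
with the interval gate data `GIx` (all seven data within relative `1/300`, `δ ∈ [0, (1 + 1/300) δ₀]`),
25 steps each, from `Bx12` to `Bx16`.
-/

namespace Literature.Analysis.FluidPDE.FluidComputer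

namespace ThresholdLevelTable

set_option maxHeartbeats 10000000 in
set_option maxRecDepth 200000 in
/-- Chunk 12 of the wider-data-box table run (steps 300 … 324). [folklore] -/
theorem runX12 : runSteps 60 12 3 GIx RbIt Bx12 chunk12 4525524321594313 = some Bx13 := by
  decide +kernel

set_option maxHeartbeats 10000000 in
set_option maxRecDepth 200000 in
/-- Chunk 13 of the wider-data-box table run (steps 325 … 349). [folklore] -/
theorem runX13 : runSteps 60 12 3 GIx RbIt Bx13 chunk13 5386115000203920 = some Bx14 := by
  decide +kernel

set_option maxHeartbeats 10000000 in
set_option maxRecDepth 200000 in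
/-- Chunk 14 of the wider-data-box table run (steps 350 … 374). [folklore] -/
theorem runX14 : runSteps 60 12 3 GIx RbIt Bx14 chunk14 6410358830024270 = some Bx15 := by
  decide +kernel

set_option maxHeartbeats 10000000 in
set_option maxRecDepth 200000 in
/-- Chunk 15 of the wider-data-box table run (steps 375 … 399). [folklore] -/
theorem runX15 : runSteps 60 12 3 GIx RbIt Bx15 chunk15 7629376708093743 = some Bx16 := by
  decide +kernel

end ThresholdLevelTable

end Literature.Analysis.FluidPDE.FluidComputer
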